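import Summits.KontsevichZagierPeriods.KontsevichZagierPeriods.Theorems.SymplecticScissorsVolumeFormOffPlaneToricA

/-!
# Toric assembly, parts B–C: one-coordinate and multilinear expansion of origin log-boxes

Helper file for the stub `stub_toricAssembly` of the line `Sketch` (card `log-polytope-hilbert-three`)
of the crux `VolumeFormOffPlane` (stmt-KontsevichZagierPeriods-14935), route `SymplecticScissors`.

Part B. For real algebraic `γ₁, γ₂ > 1` and integers `P, Q` with `γ₁ ^ P * γ₂ ^ Q > 1`, the class
of the origin log-box whose `m`-th edge is `(1, γ₁ ^ P * γ₂ ^ Q)` equals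
`P • [edge (1, γ₁)] + Q • [edge (1, γ₂)]` in `FormalRep ⧸ relations` (under the existence / cut /
scaling hypotheses, stated as the registered stub statements verbatim). Cases on the signs of
`P`, `Q`: two cuts and two scalings at most, plus the power law of part A.

Part C. Fix real algebraic `α, β > 1`. The ORIGIN BOX with exponent vectors `p q : Fin n → ℤ` is
the log-box with edges `(1, α ^ p_j * β ^ q_j)`; the UNIT BOX of a word `w : Fin n → Bool` has
edges `(1, α)` (letter `false`) or `(1, β)` (letter `true`). In `FormalRep ⧸ relations`,
`[origin box (p, q)] = ∑_w (∏_j (if w_j then q_j else p_j)) • [unit box w]` — the expansion of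
`∏_j (p_j X + q_j Y)` — by induction on the set of coordinates not yet of unit type, one
application of the one-coordinate expansion per coordinate.
-/

noncomputable section

open MeasureTheory Set
open Literature.NumberTheory.Transcendental

namespace Summit.KontsevichZagierPeriods.SymplecticScissors.LogPolytope

-- Shorthands used in the SOURCE of this file (work/toric/ToricBC.src.lean, expanded by
-- work/toric/pp.py before checking/landing; the landed file is notation-free):
--   𝔅(n, a, b)  = the log-box;  𝔅₁(n, c) = 𝔅(n, fun _ => 1, c);  π = QuotientAddGroup.mk' KZ.relations
--   HExists / HCut / HScale = the registered stub statements (verbatim).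

/-- Integer powers of algebraic numbers are algebraic. [folklore] -/
theorem toric_isAlgebraic_zpow : ∀ {x : ℝ}, IsAlgebraic ℚ x → ∀ (Q : ℤ), IsAlgebraic ℚ (x ^ Q) := by
  intro x hx Q
  cases Q with
  | ofNat k => simpa using hx.pow k
  | negSucc k => rw [zpow_negSucc]; exact (hx.pow (k + 1)).inv

/-- `zpow` monotonicity bookkeeping: for `1 < γ` and `P < 0`, `γ ^ P < 1`. [folklore] -/
theorem toric_zpow_lt_one {γ : ℝ} (hγ : 1 < γ) {P : ℤ} (hP : P < 0) : γ ^ P < 1 :=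
  zpow_lt_one_of_neg₀ hγ hP

/-! ## Part B: the one-coordinate expansion -/

/-- **One-coordinate expansion, non-negative first exponent.** For `γ₁, γ₂ > 1` real algebraic,
`P : ℕ`, `Q : ℤ` with `1 < γ₁ ^ P * γ₂ ^ Q`: the class of the origin box with `m`-th edge
`(1, γ₁ ^ P * γ₂ ^ Q)` is `P • [m-th edge (1, γ₁)] + Q • [m-th edge (1, γ₂)]`. [folklore] -/
theorem toric_coord_natCast (hEx : (∀ (n : ℕ) (a b : Fin n → ℝ), (∀ j, 0 < a j) → (∀ j, IsAlgebraic ℚ (a j)) → (∀ j, IsAlgebraic ℚ (b j)) → ∃ r : KZ.IntegralRep (n + 1), r.domain = {p : Fin (n + 1) → ℝ | (∀ j : Fin n, a j < p (Fin.castSucc j) ∧ p (Fin.castSucc j) < b j) ∧ 0 < p (Fin.last n) ∧ p (Fin.last n) * ∏ j : Fin n, p (Fin.castSucc j) < 1} ∧ r.integrand = fun _ => 1)) (hCut : (∀ (n : ℕ) (a b : Fin n → ℝ) (j : Fin n) (c : ℝ), IsAlgebraic ℚ c → a j ≤ c → c ≤ b j → ∀ (r r₁ r₂ : KZ.IntegralRep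 (n + 1)), r.domain = {p : Fin (n + 1) → ℝ | (∀ j : Fin n, a j < p (Fin.castSucc j) ∧ p (Fin.castSucc j) < b j) ∧ 0 < p (Fin.last n) ∧ p (Fin.last n) * ∏ j : Fin n, p (Fin.castSucc j) < 1} → r₁.domain = {p : Fin (n + 1) → ℝ | (∀ i : Fin n, a i < p (Fin.castSucc i) ∧ p (Fin.castSucc i) < Function.update b j c i) ∧ 0 < p (Fin.last n) ∧ p (Fin.last n) * ∏ i : Fin n, p (Fin.castSucc i) < 1} → r₂.domain = {p : Fin (n + 1) → ℝ | (∀ i : Fin n, Function.update a j c i < p (Fin.castSucc i) ∧ p (Fin.castSucc i) < b i) ∧ 0 < p (Fin.last n) ∧ p (Fin.last n) * ∏ i : Fin n, p (Fin.castSucc i) < 1} → (∀ p ∈ r.domain, r.integrand p = 1) → (∀ p ∈ r₁.domain, r₁.integrand p = 1) → (∀ p ∈ r₂.domain, r₂.integrand p = 1) → KZ.of r - KZ.of r₁ - KZ.of r₂ ∈ KZ.relations)) (hScale : (∀ (n : ℕ) (a b l : Fin n → ℝ), (∀ j, 0 < l j) → (∀ j, IsAlgebraic ℚ (l j)) → ∀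 (r r' : KZ.IntegralRep (n + 1)), r.domain = {p : Fin (n + 1) → ℝ | (∀ j : Fin n, a j < p (Fin.castSucc j) ∧ p (Fin.castSucc j) < b j) ∧ 0 < p (Fin.last n) ∧ p (Fin.last n) * ∏ j : Fin n, p (Fin.castSucc j) < 1} → r'.domain = {p : Fin (n + 1) → ℝ | (∀ j : Fin n, l j * a j < p (Fin.castSucc j) ∧ p (Fin.castSucc j) < l j * b j) ∧ 0 < p (Fin.last n) ∧ p (Fin.last n) * ∏ j : Fin n, p (Fin.castSucc j) < 1} → (∀ p ∈ r.domain, r.integrand p = 1) → (∀ p ∈ r'.domain, r'.integrand p = 1) → KZ.of r - KZ.of r' ∈ KZ.relations)) {n : ℕ}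
    (c : Fin n → ℝ) (hca : ∀ j, IsAlgebraic ℚ (c j)) (m : Fin n)
    {γ₁ γ₂ : ℝ} (hγ₁ : 1 < γ₁) (hγ₂ : 1 < γ₂) (hγ₁a : IsAlgebraic ℚ γ₁) (hγ₂a : IsAlgebraic ℚ γ₂)
    (P : ℕ) (Q : ℤ) (hPQ : 1 < γ₁ ^ P * γ₂ ^ Q)
    (u₁ u₂ r : KZ.IntegralRep (n + 1))
    (hu₁d : u₁.domain = {ξ : Fin (n + 1) → ℝ | (∀ ι : Fin n, (fun _ => (1:ℝ)) ι < ξ (Fin.castSucc ι) ∧ ξ (Fin.castSucc ι) < (Function.update c m γ₁) ι) ∧ 0 < ξ (Fin.last n) ∧ ξ (Fin.last n) * ∏ ι : Fin n, ξ (Fin.castSucc ι) < 1}) (hu₁ : ∀ x ∈ u₁.domain, u₁.integrand x = 1)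
    (hu₂d : u₂.domain = {ξ : Fin (n + 1) → ℝ | (∀ ι : Fin n, (fun _ => (1:ℝ)) ι < ξ (Fin.castSucc ι) ∧ ξ (Fin.castSucc ι) < (Function.update c m γ₂) ι) ∧ 0 < ξ (Fin.last n) ∧ ξ (Fin.last n) * ∏ ι : Fin n, ξ (Fin.castSucc ι) < 1}) (hu₂ : ∀ x ∈ u₂.domain, u₂.integrand x = 1)
    (hrd : r.domain = {ξ : Fin (n + 1) → ℝ | (∀ ι : Fin n, (fun _ => (1:ℝ)) ι < ξ (Fin.castSucc ι) ∧ ξ (Fin.castSucc ι) < (Function.update c m (γ₁ ^ P * γ₂ ^ Q)) ι) ∧ 0 < ξ (Fin.last n) ∧ ξ (Fin.last n) * ∏ ι : Fin n, ξ (Fin.castSucc ι) < 1})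
    (hr : ∀ x ∈ r.domain, r.integrand x = 1) :
    (QuotientAddGroup.mk' KZ.relations) (KZ.of r) = (P : ℤ) • (QuotientAddGroup.mk' KZ.relations) (KZ.of u₁) + Q • (QuotientAddGroup.mk' KZ.relations) (KZ.of u₂) := by
  have hγ₁0 : 0 < γ₁ := one_pos.trans hγ₁
  have hγ₂0 : 0 < γ₂ := one_pos.trans hγ₂
  have h1a : ∀ j : Fin n, IsAlgebraic ℚ ((fun _ => (1:ℝ)) j) := fun _ => isAlgebraic_one
  have h1p : ∀ j : Fin n, 0 < (fun _ => (1:ℝ)) j := fun _ => one_pos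
  set A : ℝ := γ₁ ^ P with hA
  have hA1 : 1 ≤ A := one_le_pow₀ hγ₁.le
  have hA0 : 0 < A := one_pos.trans_le hA1
  have hAa : IsAlgebraic ℚ A := hγ₁a.pow P
  rcases le_or_gt 0 Q with hQ | hQ
  · -- Q = Q' ≥ 0 : cut at x_m = A, rescale the upper piece by A⁻¹
    obtain ⟨Q', rfl⟩ := Int.eq_ofNat_of_zero_le hQ
    set B : ℝ := γ₂ ^ Q' with hB
    have hB1 : 1 ≤ B := one_le_pow₀ hγ₂.le
    have hB0 : 0 < B := one_pos.trans_le hB1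
    have hBa : IsAlgebraic ℚ B := hγ₂a.pow Q'
    have hAB : γ₁ ^ P * γ₂ ^ (Q' : ℤ) = A * B := by rw [zpow_natCast]
    rw [hAB] at hrd
    obtain ⟨r₁, r₂, hr₁d, hr₁i, hr₂d, hr₂i, hsum⟩ := toric_cut hEx hCut h1p h1a
      (toric_update_algebraic hca m (hAa.mul hBa)) m hAa (by simpa using hA1)
      (by simpa using le_mul_of_one_le_right hA0.le hB1) r hrd hr
    rw [hsum]
    -- lower piece: power law in γ₁
    have h₁ : (QuotientAddGroup.mk' KZ.relations) (KZ.of r₁) = P • (QuotientAddGroup.mk' KZ.relations) (KZ.of u₁) := by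
      refine toric_pow hEx hCut hScale c hca m hγ₁ hγ₁a u₁ hu₁d hu₁ P r₁ ?_ hr₁i
      rw [hr₁d, Function.update_idem]
    -- upper piece: rescale by A⁻¹ in coordinate m, then power law in γ₂
    obtain ⟨w, hwd, hwi⟩ := hEx n (fun _ => (1:ℝ)) (Function.update c m B) h1p h1a
      (toric_update_algebraic hca m hBa)
    have hwi' : ∀ x ∈ w.domain, w.integrand x = 1 := fun x _ => by rw [hwi]
    have h₂ : (QuotientAddGroup.mk' KZ.relations) (KZ.of r₂) = (QuotientAddGroup.mk' KZ.relations) (KZ.of w) := by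
      refine toric_rescale hEx hScale (Function.update (fun _ => (1:ℝ)) m A⁻¹)
        (toric_update_pos h1p m (inv_pos.mpr hA0)) (toric_update_algebraic h1a m hAa.inv)
        (toric_update_pos h1p m hA0) (toric_update_algebraic h1a m hAa)
        (toric_update_algebraic hca m (hAa.mul hBa)) r₂ hr₂d hr₂i
        (toric_update_one_mul_update_one m A⁻¹ A (inv_mul_cancel₀ hA0.ne')) (fun j => ?_) w hwd hwi'
      rw [toric_update_one_mul_update m c A⁻¹ (A * B) j, inv_mul_cancel_left₀ hA0.ne']
    have h₃ : (QuotientAddGroup.mk' KZ.relations) (KZ.of w) = Q' • (QuotientAddGroup.mk' KZ.relations) (KZ.of u₂) :=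
      toric_pow hEx hCut hScale c hca m hγ₂ hγ₂a u₂ hu₂d hu₂ Q' w hwd hwi'
    rw [h₁, h₂, h₃, natCast_zsmul, natCast_zsmul]
  · -- Q = -Q'' < 0 : the box with edge (1, A) splits at x_m = A * B
    obtain ⟨Q'', hQ''⟩ := Int.exists_eq_neg_ofNat hQ.le
    set B : ℝ := γ₂ ^ Q with hB
    have hB0 : 0 < B := zpow_pos hγ₂0 Q
    have hB1 : B < 1 := toric_zpow_lt_one hγ₂ hQ
    have hBa : IsAlgebraic ℚ B := toric_isAlgebraic_zpow hγ₂a Q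
    have hBinv : B⁻¹ = γ₂ ^ Q'' := by rw [hB, hQ'', zpow_neg, zpow_natCast, inv_inv]
    have hAB1 : A * B ≤ A := mul_le_of_le_one_right hA0.le hB1.le
    -- s on the box with edge (1, A)
    obtain ⟨s, hsd, hsi⟩ := hEx n (fun _ => (1:ℝ)) (Function.update c m A) h1p h1a
      (toric_update_algebraic hca m hAa)
    have hsi' : ∀ x ∈ s.domain, s.integrand x = 1 := fun x _ => by rw [hsi]
    have hs : (QuotientAddGroup.mk' KZ.relations) (KZ.of s) = P • (QuotientAddGroup.mk' KZ.relations) (KZ.of u₁) :=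
      toric_pow hEx hCut hScale c hca m hγ₁ hγ₁a u₁ hu₁d hu₁ P s hsd hsi'
    obtain ⟨s₁, s₂, hs₁d, hs₁i, hs₂d, hs₂i, hsum⟩ := toric_cut hEx hCut h1p h1a
      (toric_update_algebraic hca m hAa) m (hAa.mul hBa) (by simpa using hPQ.le)
      (by simpa using hAB1) s hsd hsi'
    -- s₁ has the domain of r
    have h₁ : (QuotientAddGroup.mk' KZ.relations) (KZ.of s₁) = (QuotientAddGroup.mk' KZ.relations) (KZ.of r) := by
      refine toric_mk_eq_of_domain_eq ?_ hs₁i hr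
      rw [hs₁d, hrd, Function.update_idem]
    -- s₂ rescaled by (A B)⁻¹ is the box with edge (1, B⁻¹) = (1, γ₂ ^ Q'')
    obtain ⟨w, hwd, hwi⟩ := hEx n (fun _ => (1:ℝ)) (Function.update c m (γ₂ ^ Q'')) h1p h1a
      (toric_update_algebraic hca m (hγ₂a.pow Q''))
    have hwi' : ∀ x ∈ w.domain, w.integrand x = 1 := fun x _ => by rw [hwi]
    have hAB0 : 0 < A * B := mul_pos hA0 hB0
    have h₂ : (QuotientAddGroup.mk' KZ.relations) (KZ.of s₂) = (QuotientAddGroup.mk' KZ.relations) (KZ.of w) := by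
      refine toric_rescale hEx hScale (Function.update (fun _ => (1:ℝ)) m (A * B)⁻¹)
        (toric_update_pos h1p m (inv_pos.mpr hAB0)) (toric_update_algebraic h1a m (hAa.mul hBa).inv)
        (toric_update_pos h1p m hAB0) (toric_update_algebraic h1a m (hAa.mul hBa))
        (toric_update_algebraic hca m hAa) s₂ hs₂d hs₂i
        (toric_update_one_mul_update_one m (A * B)⁻¹ (A * B) (inv_mul_cancel₀ hAB0.ne'))
        (fun j => ?_) w hwd hwi'
      rw [toric_update_one_mul_update m c (A * B)⁻¹ A j, ← hBinv, mul_inv_rev,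
        inv_mul_cancel_right₀ hA0.ne']
    have h₃ : (QuotientAddGroup.mk' KZ.relations) (KZ.of w) = Q'' • (QuotientAddGroup.mk' KZ.relations) (KZ.of u₂) :=
      toric_pow hEx hCut hScale c hca m hγ₂ hγ₂a u₂ hu₂d hu₂ Q'' w hwd hwi'
    have hr' : (QuotientAddGroup.mk' KZ.relations) (KZ.of r) = (QuotientAddGroup.mk' KZ.relations) (KZ.of s) - (QuotientAddGroup.mk' KZ.relations) (KZ.of s₂) := by
      rw [hsum, h₁]; abel
    rw [hr', hs, h₂, h₃, hQ'', neg_smul, natCast_zsmul, natCast_zsmul, sub_eq_add_neg]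

/-- **One-coordinate expansion of an origin log-box.** For `γ₁, γ₂ > 1` real algebraic and
`P, Q : ℤ` with `1 < γ₁ ^ P * γ₂ ^ Q` (the edge is non-empty): the class of the origin box with
`m`-th edge `(1, γ₁ ^ P * γ₂ ^ Q)` is `P • [m-th edge (1, γ₁)] + Q • [m-th edge (1, γ₂)]`.
(`P, Q < 0` is impossible; otherwise reduce to `toric_coord_natCast` by symmetry.) [folklore] -/
theorem toric_coord (hEx : (∀ (n : ℕ) (a b : Fin n → ℝ), (∀ j, 0 < a j) → (∀ j, IsAlgebraic ℚ (a j)) → (∀ j, IsAlgebraic ℚ (b j)) → ∃ r : KZ.IntegralRep (n + 1), r.domain = {p : Fin (n + 1) → ℝ | (∀ j : Fin n, a j < p (Fin.castSucc j) ∧ p (Fin.castSucc j) < b j) ∧ 0 < p (Fin.last n) ∧ p (Fin.last n) * ∏ j : Fin n, p (Fin.castSucc j) < 1} ∧ r.integrand = fun _ => 1)) (hCut : (∀ (n : ℕ) (a b : Fin n → ℝ) (j : Fin n) (c : ℝ), IsAlgebraic ℚ c → a j ≤ c → c ≤ b j → ∀ (r r₁ r₂ : KZ.IntegralRep (n + 1)),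 r.domain = {p : Fin (n + 1) → ℝ | (∀ j : Fin n, a j < p (Fin.castSucc j) ∧ p (Fin.castSucc j) < b j) ∧ 0 < p (Fin.last n) ∧ p (Fin.last n) * ∏ j : Fin n, p (Fin.castSucc j) < 1} → r₁.domain = {p : Fin (n + 1) → ℝ | (∀ i : Fin n, a i < p (Fin.castSucc i) ∧ p (Fin.castSucc i) < Function.update b j c i) ∧ 0 < p (Fin.last n) ∧ p (Fin.last n) * ∏ i : Fin n, p (Fin.castSucc i) < 1} → r₂.domain = {p : Fin (n + 1) → ℝ | (∀ i : Fin n, Function.update a j c i < p (Fin.castSucc i) ∧ p (Fin.castSucc i) < b i) ∧ 0 < p (Fin.last n) ∧ p (Fin.last n) * ∏ i : Fin n, p (Fin.castSucc i) < 1} → (∀ p ∈ r.domain, r.integrand p = 1) → (∀ p ∈ r₁.domain, r₁.integrand p = 1) → (∀ p ∈ r₂.domain, r₂.integrand p = 1) → KZ.of r - KZ.of r₁ - KZ.of r₂ ∈ KZ.relations)) (hScale : (∀ (n : ℕ) (a b l : Fin n → ℝ), (∀ j, 0 < l j) → (∀ j, IsAlgebraic ℚ (l j)) → ∀ (r r'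 : KZ.IntegralRep (n + 1)), r.domain = {p : Fin (n + 1) → ℝ | (∀ j : Fin n, a j < p (Fin.castSucc j) ∧ p (Fin.castSucc j) < b j) ∧ 0 < p (Fin.last n) ∧ p (Fin.last n) * ∏ j : Fin n, p (Fin.castSucc j) < 1} → r'.domain = {p : Fin (n + 1) → ℝ | (∀ j : Fin n, l j * a j < p (Fin.castSucc j) ∧ p (Fin.castSucc j) < l j * b j) ∧ 0 < p (Fin.last n) ∧ p (Fin.last n) * ∏ j : Fin n, p (Fin.castSucc j) < 1} → (∀ p ∈ r.domain, r.integrand p = 1) → (∀ p ∈ r'.domain, r'.integrand p = 1) → KZ.of r - KZ.of r' ∈ KZ.relations)) {n : ℕ}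
    (c : Fin n → ℝ) (hca : ∀ j, IsAlgebraic ℚ (c j)) (m : Fin n)
    {γ₁ γ₂ : ℝ} (hγ₁ : 1 < γ₁) (hγ₂ : 1 < γ₂) (hγ₁a : IsAlgebraic ℚ γ₁) (hγ₂a : IsAlgebraic ℚ γ₂)
    (P Q : ℤ) (hPQ : 1 < γ₁ ^ P * γ₂ ^ Q)
    (u₁ u₂ r : KZ.IntegralRep (n + 1))
    (hu₁d : u₁.domain = {ξ : Fin (n + 1) → ℝ | (∀ ι : Fin n, (fun _ => (1:ℝ)) ι < ξ (Fin.castSucc ι) ∧ ξ (Fin.castSucc ι) < (Function.update c m γ₁) ι) ∧ 0 < ξ (Fin.last n) ∧ ξ (Fin.last n) * ∏ ι : Fin n, ξ (Fin.castSucc ι) < 1}) (hu₁ : ∀ x ∈ u₁.domain, u₁.integrand x = 1)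
    (hu₂d : u₂.domain = {ξ : Fin (n + 1) → ℝ | (∀ ι : Fin n, (fun _ => (1:ℝ)) ι < ξ (Fin.castSucc ι) ∧ ξ (Fin.castSucc ι) < (Function.update c m γ₂) ι) ∧ 0 < ξ (Fin.last n) ∧ ξ (Fin.last n) * ∏ ι : Fin n, ξ (Fin.castSucc ι) < 1}) (hu₂ : ∀ x ∈ u₂.domain, u₂.integrand x = 1)
    (hrd : r.domain = {ξ : Fin (n + 1) → ℝ | (∀ ι : Fin n, (fun _ => (1:ℝ)) ι < ξ (Fin.castSucc ι) ∧ ξ (Fin.castSucc ι) < (Function.update c m (γ₁ ^ P * γ₂ ^ Q)) ι) ∧ 0 < ξ (Fin.last n) ∧ ξ (Fin.last n) * ∏ ι : Fin n, ξ (Fin.castSucc ι) < 1})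
    (hr : ∀ x ∈ r.domain, r.integrand x = 1) :
    (QuotientAddGroup.mk' KZ.relations) (KZ.of r) = P • (QuotientAddGroup.mk' KZ.relations) (KZ.of u₁) + Q • (QuotientAddGroup.mk' KZ.relations) (KZ.of u₂) := by
  rcases le_or_gt 0 P with hP | hP
  · obtain ⟨P', rfl⟩ := Int.eq_ofNat_of_zero_le hP
    rw [zpow_natCast] at hPQ hrd
    exact toric_coord_natCast hEx hCut hScale c hca m hγ₁ hγ₂ hγ₁a hγ₂a P' Q hPQ u₁ u₂ r
      hu₁d hu₁ hu₂d hu₂ hrd hr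
  rcases le_or_gt 0 Q with hQ | hQ
  · obtain ⟨Q', rfl⟩ := Int.eq_ofNat_of_zero_le hQ
    rw [mul_comm] at hPQ hrd
    rw [zpow_natCast] at hPQ hrd
    exact (toric_coord_natCast hEx hCut hScale c hca m hγ₂ hγ₁ hγ₂a hγ₁a Q' P hPQ u₂ u₁ r
      hu₂d hu₂ hu₁d hu₁ hrd hr).trans (add_comm _ _)
  · exact absurd hPQ (not_lt.mpr (mul_le_one₀ (toric_zpow_lt_one hγ₁ hP).le
      (zpow_pos (one_pos.trans hγ₂) Q).le (toric_zpow_lt_one hγ₂ hQ).le))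


/-! ## Part C: the coefficient algebra of the expansion -/

/-- The expansion is linear in the `m`-th exponent pair: `RHS (p, q) = p_m • RHS (p[m↦1], q[m↦0])
+ q_m • RHS (p[m↦0], q[m↦1])`, as an identity of `ℤ`-combinations in any additive commutative
group. [folklore] -/
theorem toric_rhs_split {G : Type*} [AddCommGroup G] {n : ℕ} (p q : Fin n → ℤ) (m : Fin n)
    (U : (Fin n → Bool) → G) :
    ∑ w : Fin n → Bool, (∏ j, (if w j = true then q j else p j)) • U w =
      p m • ∑ w : Fin n → Bool,
          (∏ j, (if w j = true then Function.update q m 0 j else Function.update p m 1 j)) • U w +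
        q m • ∑ w : Fin n → Bool,
          (∏ j, (if w j = true then Function.update q m 1 j else Function.update p m 0 j)) • U w := by
  rw [Finset.smul_sum, Finset.smul_sum, ← Finset.sum_add_distrib]
  refine Finset.sum_congr rfl fun w _ => ?_
  rw [smul_smul, smul_smul, ← add_smul]
  congr 1
  rw [← Finset.mul_prod_erase Finset.univ _ (Finset.mem_univ m),
    ← Finset.mul_prod_erase Finset.univ (fun j => if w j = true then Function.update q m 0 j
      else Function.update p m 1 j) (Finset.mem_univ m),
    ← Finset.mul_prod_erase Finset.univ (fun j => if w j = true then Function.update q m 1 j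
      else Function.update p m 0 j) (Finset.mem_univ m)]
  have hrest₁ : ∏ j ∈ Finset.univ.erase m, (if w j = true then Function.update q m 0 j
      else Function.update p m 1 j) = ∏ j ∈ Finset.univ.erase m, (if w j = true then q j else p j) :=
    Finset.prod_congr rfl fun j hj => by simp [Function.update_of_ne (Finset.ne_of_mem_erase hj)]
  have hrest₂ : ∏ j ∈ Finset.univ.erase m, (if w j = true then Function.update q m 1 j
      else Function.update p m 0 j) = ∏ j ∈ Finset.univ.erase m, (if w j = true then q j else p j) :=
    Finset.prod_congr rfl fun j hj => by simp [Function.update_of_ne (Finset.ne_of_mem_erase hj)]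
  rw [hrest₁, hrest₂]
  cases w m <;> simp

/-- The expansion of a box all of whose edges are unit letters has exactly one term: with
`w₀ j = decide (p j = 0)`, the coefficient of `w` is `1` if `w = w₀` and `0` otherwise. [folklore] -/
theorem toric_coeff_unit {n : ℕ} (p q : Fin n → ℤ)
    (hunit : ∀ j, (p j = 1 ∧ q j = 0) ∨ (p j = 0 ∧ q j = 1)) (w : Fin n → Bool) :
    (∏ j, (if w j = true then q j else p j)) =
      if w = (fun j => decide (p j = 0)) then 1 else 0 := by
  split_ifs with hw
  · subst hw
    refine Finset.prod_eq_one fun j _ => ?_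
    rcases hunit j with ⟨h1, h2⟩ | ⟨h1, h2⟩ <;> simp [h1, h2]
  · obtain ⟨j, hj⟩ : ∃ j, w j ≠ decide (p j = 0) := by
      by_contra h
      push Not at h
      exact hw (funext h)
    refine Finset.prod_eq_zero (Finset.mem_univ j) ?_
    rcases hunit j with ⟨h1, h2⟩ | ⟨h1, h2⟩
    · have : w j = true := by simpa [h1] using hj
      simp [this, h2]
    · have : w j = false := by simpa [h1] using hj
      simp [this, h1]

/-! ## The expansion -/

/-- **Multilinear expansion, inductive form.** For `α, β > 1` real algebraic, a unit family `U`
(`U w` an integrand-`1` representation on the unit box of the word `w`) and exponent vectors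
`p, q` with non-empty edges which are ALREADY unit letters off the finite set `T`: the class of
the origin box `(p, q)` is `∑_w (∏_j (if w_j then q_j else p_j)) • [U w]`. Induction on `T`.
[folklore] -/
theorem toric_expand_aux (hEx : (∀ (n : ℕ) (a b : Fin n → ℝ), (∀ j, 0 < a j) → (∀ j, IsAlgebraic ℚ (a j)) → (∀ j, IsAlgebraic ℚ (b j)) → ∃ r : KZ.IntegralRep (n + 1), r.domain = {p : Fin (n + 1) → ℝ | (∀ j : Fin n, a j < p (Fin.castSucc j) ∧ p (Fin.castSucc j) < b j) ∧ 0 < p (Fin.last n) ∧ p (Fin.last n) * ∏ j : Fin n, p (Fin.castSucc j) < 1} ∧ r.integrand = fun _ => 1)) (hCut : (∀ (n : ℕ) (a b : Fin n → ℝ) (j : Fin n) (c : ℝ), IsAlgebraic ℚ c → a j ≤ c → c ≤ b j → ∀ (r r₁ r₂ : KZ.IntegralRep (n + 1)), r.domain = {p : Fin (n + 1) → ℝ | (∀ j : Fin n, a j < p (Fin.castSucc j) ∧ p (Fin.castSucc j) < b j) ∧ 0 < p (Fin.last n) ∧ p (Fin.last n) * ∏ j : Fin n, p (Fin.castSucc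 j) < 1} → r₁.domain = {p : Fin (n + 1) → ℝ | (∀ i : Fin n, a i < p (Fin.castSucc i) ∧ p (Fin.castSucc i) < Function.update b j c i) ∧ 0 < p (Fin.last n) ∧ p (Fin.last n) * ∏ i : Fin n, p (Fin.castSucc i) < 1} → r₂.domain = {p : Fin (n + 1) → ℝ | (∀ i : Fin n, Function.update a j c i < p (Fin.castSucc i) ∧ p (Fin.castSucc i) < b i) ∧ 0 < p (Fin.last n) ∧ p (Fin.last n) * ∏ i : Fin n, p (Fin.castSucc i) < 1} → (∀ p ∈ r.domain, r.integrand p = 1) → (∀ p ∈ r₁.domain, r₁.integrand p = 1) → (∀ p ∈ r₂.domain, r₂.integrand p = 1) → KZ.of r - KZ.of r₁ - KZ.of r₂ ∈ KZ.relations)) (hScale : (∀ (n : ℕ) (a b l : Fin n → ℝ), (∀ j, 0 < l j) → (∀ j, IsAlgebraic ℚ (l j)) → ∀ (r r' : KZ.IntegralRep (n + 1)), r.domain = {p : Fin (n + 1) → ℝ | (∀ j : Fin n, a j < p (Fin.castSucc j) ∧ p (Fin.castSucc j) < b j) ∧ 0 < p (Fin.last n) ∧ p (Fin.last n) * ∏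 j : Fin n, p (Fin.castSucc j) < 1} → r'.domain = {p : Fin (n + 1) → ℝ | (∀ j : Fin n, l j * a j < p (Fin.castSucc j) ∧ p (Fin.castSucc j) < l j * b j) ∧ 0 < p (Fin.last n) ∧ p (Fin.last n) * ∏ j : Fin n, p (Fin.castSucc j) < 1} → (∀ p ∈ r.domain, r.integrand p = 1) → (∀ p ∈ r'.domain, r'.integrand p = 1) → KZ.of r - KZ.of r' ∈ KZ.relations)) {n : ℕ}
    {α β : ℝ} (hα : 1 < α) (hβ : 1 < β) (hαa : IsAlgebraic ℚ α) (hβa : IsAlgebraic ℚ β)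
    (U : (Fin n → Bool) → KZ.IntegralRep (n + 1))
    (hUd : ∀ w, (U w).domain = {ξ : Fin (n + 1) → ℝ | (∀ ι : Fin n, (fun _ => (1:ℝ)) ι < ξ (Fin.castSucc ι) ∧ ξ (Fin.castSucc ι) < (fun j => if w j = true then β else α) ι) ∧ 0 < ξ (Fin.last n) ∧ ξ (Fin.last n) * ∏ ι : Fin n, ξ (Fin.castSucc ι) < 1})
    (hU : ∀ w, ∀ x ∈ (U w).domain, (U w).integrand x = 1) (T : Finset (Fin n)) :
    ∀ (p q : Fin n → ℤ), (∀ j, 1 < α ^ p j * β ^ q j) →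
      (∀ j, j ∉ T → (p j = 1 ∧ q j = 0) ∨ (p j = 0 ∧ q j = 1)) →
      ∀ (r : KZ.IntegralRep (n + 1)), r.domain = {ξ : Fin (n + 1) → ℝ | (∀ ι : Fin n, (fun _ => (1:ℝ)) ι < ξ (Fin.castSucc ι) ∧ ξ (Fin.castSucc ι) < (fun j => α ^ p j * β ^ q j) ι) ∧ 0 < ξ (Fin.last n) ∧ ξ (Fin.last n) * ∏ ι : Fin n, ξ (Fin.castSucc ι) < 1} →
      (∀ x ∈ r.domain, r.integrand x = 1) →
      (QuotientAddGroup.mk' KZ.relations) (KZ.of r) = ∑ w : Fin n → Bool, (∏ j, (if w j = true then q j else p j)) • (QuotientAddGroup.mk' KZ.relations) (KZ.of (U w)) := by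
  have hα0 : 0 < α := one_pos.trans hα
  have hβ0 : 0 < β := one_pos.trans hβ
  induction T using Finset.induction_on with
  | empty =>
    intro p q _hpq hunit r hrd hr
    have hunit' : ∀ j, (p j = 1 ∧ q j = 0) ∨ (p j = 0 ∧ q j = 1) := fun j => hunit j (by simp)
    simp_rw [toric_coeff_unit p q hunit', ite_smul, one_smul, zero_smul, Finset.sum_ite_eq',
      Finset.mem_univ, if_true]
    refine toric_mk_eq_of_domain_eq ?_ hr (hU _)
    rw [hrd, hUd]
    have hcorner : ∀ j, α ^ p j * β ^ q j = if decide (p j = 0) = true then β else α := by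
      intro j
      rcases hunit' j with ⟨h1, h2⟩ | ⟨h1, h2⟩ <;> simp [h1, h2]
    ext x
    simp only [mem_setOf_eq, hcorner]
  | insert m T hmT ih =>
    intro p q hpq hunit r hrd hr
    -- the context vector and its algebraicity
    have hca : ∀ j, IsAlgebraic ℚ (α ^ p j * β ^ q j) := fun j => (toric_isAlgebraic_zpow hαa _).mul (toric_isAlgebraic_zpow hβa _)
    -- the two unit-letter neighbours in coordinate m
    set p₁ : Fin n → ℤ := Function.update p m 1 with hp₁
    set q₁ : Fin n → ℤ := Function.update q m 0 with hq₁
    set p₂ : Fin n → ℤ := Function.update p m 0 with hp₂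
    set q₂ : Fin n → ℤ := Function.update q m 1 with hq₂
    have hc₁ : ∀ j, α ^ p₁ j * β ^ q₁ j = Function.update (fun j => α ^ p j * β ^ q j) m α j := by
      intro j
      rcases eq_or_ne j m with rfl | h
      · simp [hp₁, hq₁]
      · simp [hp₁, hq₁, Function.update_of_ne h]
    have hc₂ : ∀ j, α ^ p₂ j * β ^ q₂ j = Function.update (fun j => α ^ p j * β ^ q j) m β j := by
      intro j
      rcases eq_or_ne j m with rfl | h
      · simp [hp₂, hq₂]
      · simp [hp₂, hq₂, Function.update_of_ne h]
    have hpq₁ : ∀ j, 1 < α ^ p₁ j * β ^ q₁ j := by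
      intro j; rw [hc₁]
      rcases eq_or_ne j m with rfl | h
      · simpa using hα
      · simpa [Function.update_of_ne h] using hpq j
    have hpq₂ : ∀ j, 1 < α ^ p₂ j * β ^ q₂ j := by
      intro j; rw [hc₂]
      rcases eq_or_ne j m with rfl | h
      · simpa using hβ
      · simpa [Function.update_of_ne h] using hpq j
    have hunit₁ : ∀ j, j ∉ T → (p₁ j = 1 ∧ q₁ j = 0) ∨ (p₁ j = 0 ∧ q₁ j = 1) := by
      intro j hj
      rcases eq_or_ne j m with rfl | h
      · left; simp [hp₁, hq₁]
      · simpa [hp₁, hq₁, Function.update_of_ne h] using hunit j (by simp [h, hj])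
    have hunit₂ : ∀ j, j ∉ T → (p₂ j = 1 ∧ q₂ j = 0) ∨ (p₂ j = 0 ∧ q₂ j = 1) := by
      intro j hj
      rcases eq_or_ne j m with rfl | h
      · right; simp [hp₂, hq₂]
      · simpa [hp₂, hq₂, Function.update_of_ne h] using hunit j (by simp [h, hj])
    -- representations on the two neighbours
    obtain ⟨u₁, hu₁d, hu₁i⟩ := hEx n (fun _ => (1:ℝ)) (fun j => α ^ p₁ j * β ^ q₁ j)
      (fun _ => one_pos) (fun _ => isAlgebraic_one) (fun j => (toric_isAlgebraic_zpow hαa _).mul (toric_isAlgebraic_zpow hβa _))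
    obtain ⟨u₂, hu₂d, hu₂i⟩ := hEx n (fun _ => (1:ℝ)) (fun j => α ^ p₂ j * β ^ q₂ j)
      (fun _ => one_pos) (fun _ => isAlgebraic_one) (fun j => (toric_isAlgebraic_zpow hαa _).mul (toric_isAlgebraic_zpow hβa _))
    have hu₁i' : ∀ x ∈ u₁.domain, u₁.integrand x = 1 := fun x _ => by rw [hu₁i]
    have hu₂i' : ∀ x ∈ u₂.domain, u₂.integrand x = 1 := fun x _ => by rw [hu₂i]
    -- one-coordinate expansion at m
    have hcoord : (QuotientAddGroup.mk' KZ.relations) (KZ.of r) = p m • (QuotientAddGroup.mk' KZ.relations) (KZ.of u₁) + q m • (QuotientAddGroup.mk' KZ.relations) (KZ.of u₂) := by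
      refine toric_coord hEx hCut hScale (fun j => α ^ p j * β ^ q j) hca m hα hβ hαa hβa
        (p m) (q m) (hpq m) u₁ u₂ r ?_ hu₁i' ?_ hu₂i' ?_ hr
      · rw [hu₁d]; ext x; simp only [mem_setOf_eq, hc₁]
      · rw [hu₂d]; ext x; simp only [mem_setOf_eq, hc₂]
      · rw [hrd, Function.update_eq_self]
    rw [hcoord, ih p₁ q₁ hpq₁ hunit₁ u₁ hu₁d hu₁i', ih p₂ q₂ hpq₂ hunit₂ u₂ hu₂d hu₂i',
      toric_rhs_split p q m]

/-- **Multilinear expansion of an origin log-box in the unit log-boxes.** For `α, β > 1` real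
algebraic and exponent vectors `p, q : Fin n → ℤ` with non-empty edges
(`1 < α ^ p_j * β ^ q_j`): in `FormalRep ⧸ relations`,
`[origin box (p, q)] = ∑_w (∏_j (if w_j then q_j else p_j)) • [unit box w]`. [folklore] -/
theorem toric_expand (hEx : (∀ (n : ℕ) (a b : Fin n → ℝ), (∀ j, 0 < a j) → (∀ j, IsAlgebraic ℚ (a j)) → (∀ j, IsAlgebraic ℚ (b j)) → ∃ r : KZ.IntegralRep (n + 1), r.domain = {p : Fin (n + 1) → ℝ | (∀ j : Fin n, a j < p (Fin.castSucc j) ∧ p (Fin.castSucc j) < b j) ∧ 0 < p (Fin.last n) ∧ p (Fin.last n) * ∏ j : Fin n, p (Fin.castSucc j) < 1} ∧ r.integrand = fun _ => 1)) (hCut : (∀ (n : ℕ) (a b : Fin n → ℝ) (j : Fin n) (c : ℝ), IsAlgebraic ℚ c → a j ≤ c → c ≤ b j → ∀ (r r₁ r₂ : KZ.IntegralRep (n + 1)), r.domain = {p : Fin (n + 1) → ℝ | (∀ j : Fin n, a j < p (Fin.castSucc j) ∧ p (Fin.castSucc j) < b j) ∧ 0 < p (Fin.last n) ∧ p (Fin.last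 n) * ∏ j : Fin n, p (Fin.castSucc j) < 1} → r₁.domain = {p : Fin (n + 1) → ℝ | (∀ i : Fin n, a i < p (Fin.castSucc i) ∧ p (Fin.castSucc i) < Function.update b j c i) ∧ 0 < p (Fin.last n) ∧ p (Fin.last n) * ∏ i : Fin n, p (Fin.castSucc i) < 1} → r₂.domain = {p : Fin (n + 1) → ℝ | (∀ i : Fin n, Function.update a j c i < p (Fin.castSucc i) ∧ p (Fin.castSucc i) < b i) ∧ 0 < p (Fin.last n) ∧ p (Fin.last n) * ∏ i : Fin n, p (Fin.castSucc i) < 1} → (∀ p ∈ r.domain, r.integrand p = 1) → (∀ p ∈ r₁.domain, r₁.integrand p = 1) → (∀ p ∈ r₂.domain, r₂.integrand p = 1) → KZ.of r - KZ.of r₁ - KZ.of r₂ ∈ KZ.relations)) (hScale : (∀ (n : ℕ) (a b l : Fin n → ℝ), (∀ j, 0 < l j) → (∀ j, IsAlgebraic ℚ (l j)) → ∀ (r r' : KZ.IntegralRep (n + 1)), r.domain = {p : Fin (n + 1) → ℝ | (∀ j : Fin n, a j < p (Fin.castSucc j) ∧ p (Fin.castSucc j) < b j) ∧ 0 < p (Fin.last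 n) ∧ p (Fin.last n) * ∏ j : Fin n, p (Fin.castSucc j) < 1} → r'.domain = {p : Fin (n + 1) → ℝ | (∀ j : Fin n, l j * a j < p (Fin.castSucc j) ∧ p (Fin.castSucc j) < l j * b j) ∧ 0 < p (Fin.last n) ∧ p (Fin.last n) * ∏ j : Fin n, p (Fin.castSucc j) < 1} → (∀ p ∈ r.domain, r.integrand p = 1) → (∀ p ∈ r'.domain, r'.integrand p = 1) → KZ.of r - KZ.of r' ∈ KZ.relations)) {n : ℕ}
    {α β : ℝ} (hα : 1 < α) (hβ : 1 < β) (hαa : IsAlgebraic ℚ α) (hβa : IsAlgebraic ℚ β)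
    (U : (Fin n → Bool) → KZ.IntegralRep (n + 1))
    (hUd : ∀ w, (U w).domain = {ξ : Fin (n + 1) → ℝ | (∀ ι : Fin n, (fun _ => (1:ℝ)) ι < ξ (Fin.castSucc ι) ∧ ξ (Fin.castSucc ι) < (fun j => if w j = true then β else α) ι) ∧ 0 < ξ (Fin.last n) ∧ ξ (Fin.last n) * ∏ ι : Fin n, ξ (Fin.castSucc ι) < 1})
    (hU : ∀ w, ∀ x ∈ (U w).domain, (U w).integrand x = 1)
    (p q : Fin n → ℤ) (hpq : ∀ j, 1 < α ^ p j * β ^ q j)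
    (r : KZ.IntegralRep (n + 1)) (hrd : r.domain = {ξ : Fin (n + 1) → ℝ | (∀ ι : Fin n, (fun _ => (1:ℝ)) ι < ξ (Fin.castSucc ι) ∧ ξ (Fin.castSucc ι) < (fun j => α ^ p j * β ^ q j) ι) ∧ 0 < ξ (Fin.last n) ∧ ξ (Fin.last n) * ∏ ι : Fin n, ξ (Fin.castSucc ι) < 1})
    (hr : ∀ x ∈ r.domain, r.integrand x = 1) :
    (QuotientAddGroup.mk' KZ.relations) (KZ.of r) = ∑ w : Fin n → Bool, (∏ j, (if w j = true then q j else p j)) • (QuotientAddGroup.mk' KZ.relations) (KZ.of (U w)) :=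
  toric_expand_aux hEx hCut hScale hα hβ hαa hβa U hUd hU Finset.univ p q hpq
    (fun j hj => absurd (Finset.mem_univ j) hj) r hrd hr

end Summit.KontsevichZagierPeriods.SymplecticScissors.LogPolytope

end
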